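import Literature.Geometry.Kaehler.ComplexTorusSimpleLefschetzLieAlgebraCenterDimension
import Literature.Geometry.Kaehler.ComplexTorusLefschetzLieAlgebraRatSemisimpleIsogenyFactors
import Literature.Algebra.Lie.RankInvariance
import HarnessLib

/-!
# Milne's Prop. 1.5 for the CENTRE and for the SEMISIMPLE PART of `Lie S(X)`: for `X ∼ ∏ₖ B_k^{n_k}`,
# `𝔷(Lie S(X)) ≅ ⨁ₖ 𝔷(Lie S(B_k))`, `dim 𝔷(Lie S(X)) = Σₖ dim 𝔷(Lie S(B_k)) = Σₖ ([K_k : ℚ] − [K_k⁺ : ℚ])` (the rank of `S₀`,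
# summed over the factors of type IV) and `dim 𝒟Lie S(X) = Σₖ dim 𝒟Lie S(B_k)`

Layer `Literature/Geometry/Kaehler`, namespace `Literature.Geometry.Kaehler.ComplexTorus`; lane `lit-hodgefound` (Track 2
foundations library); prover seat `lit-hodgefound-p17`, generation 60, self-proposed row g60-#6 — the factor-level form of ✔ g60-#5
(`dim 𝔷(Lie S(B)) + [K⁺:ℚ] = [K:ℚ]` for `B` simple), carried along p36's Prop. 1.5 at the `ℚ`-Lie algebra
(`IsIsogenous.nonempty_lefschetzLieRat_lieEquiv_directSum_of_powers`: `Lie S(X) ≃ₗ⁅ℚ⁆ ⨁ₖ Lie S(B_k)`) by the centre along a Lie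
isomorphism (tree: `Literature.Algebra.Lie.finrank_center_eq_of_lieEquiv`, `RankInvariance`) and one piece of plumbing proved here:
the centre of a finite direct sum AS A MODULE (✔ g60-#3 had the `= 0` version only).  THEOREMS ONLY (no definition, no instance, no notation, no named fact; D-0026 net debt `0`).

## Sources, VERBATIM

* J. S. Milne [Milne1999LefschetzClasses], Duke Math. J. **96** (1999) (held `paper:doi-10-1215-s0012-7094-99-09620-5`), §1 Prop. 1.1
  (p. 643: «`C(A × B) ≃ C(A) × C(B)`», «`S(A × B) ≃ S(A) × S(B)`»), Prop. 1.5 (p. 644: «Any such isogeny induces an isomorphism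
  `S(A₁) × ⋯ × S(A_s) → S(A)`»), p. 645 («`C₀(A)` … is a product of fields, each of which is either a CM-field or [totally real] …
  `S₀(A)(R) = {γ ∈ C₀(A) ⊗_ℚ R ∣ γ†γ = 1}`», and Prop. 1.7's first sentence «Both `C₀(A)` and `C(A)` satisfy the statement of
  Proposition 1.1»), §2 p. 646 and Summary table p. 652.
* H. Lange [Lange2023AbelianVarietiesComplex], §2.6.1 (p. 137: `e`, `e₀`) and §7.2.4 Exercise (4)(c) («`Lf(X) ≃ Lf(X₁) × ⋯ × Lf(X_r)`»).
* N. Bourbaki [Bourbaki1989LieGroups13], *Lie Groups and Lie Algebras* Ch. I §1 no. 1 (product of Lie algebras; the centre of a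
  product is the product of the centres) and §6 no. 4 Prop. 5 ((c) `𝔤 = 𝔷 × 𝒟𝔤`).

## What is proved

* §1 plumbing (any commutative ring `R`): **`nonempty_center_directSum_linearEquiv_pi`** (`𝔷(⨁ₖ L_k) ≃ₗ[R] Πₖ 𝔷(L_k)`, `κ` finite),
  **`finrank_center_directSum_eq_sum`**.
* §2 `X ∼ ∏ₖ B_k^{n_k}` (`B_k` simple pairwise non-isogenous polarised, `n_k ≥ 1`): **`IsIsogenous.finrank_center_lefschetzLieRat_eq_sum`**
  (`dim_ℚ 𝔷(Lie S(X)) = Σₖ dim_ℚ 𝔷(Lie S(B_k))`), **`IsIsogenous.finrank_center_lefschetzLieRat_add_sum_eq_sum`**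
  (`dim 𝔷(Lie S(X)) + Σₖ [K_k⁺ : ℚ] = Σₖ [K_k : ℚ]` — THE RANK OF MILNE'S `S₀`: `Σ` over the type IV factors of `e₀(B_k)`),
  **`IsIsogenous.finrank_derived_lefschetzLieRat_eq_sum`** (`dim 𝒟Lie S(X) = Σₖ dim 𝒟Lie S(B_k)`), and
  `IsIsogenous.finrank_center_lefschetzLieRat_eq_zero_of_forall_isTotallyReal` (no type IV factor ⟹ `dim 𝔷 = 0`, the count behind ✔ g60-#3).

NOT here: «independent of the choice of the isogeny» as an equality of maps; the `𝔾_m`-factor of Milne's `L(A)` (Thm. 4.4).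
-/

noncomputable section

open scoped Matrix DirectSum
open Module Matrix Complex Function NumberField

namespace Literature.Geometry.Kaehler

namespace ComplexTorus

/-! ## §1 The centre of a finite direct sum, as a module -/

section CenterPlumbing

variable {R : Type*} [CommRing R]

variable {κ : Type*} [Fintype κ] [DecidableEq κ] {M : κ → Type*} [∀ k, LieRing (M k)] [∀ k, LieAlgebra R (M k)]

omit [Fintype κ] in
/-- Components of a central element of `⨁ₖ L_k` are central. [cite: Bourbaki1989LieGroups13, Ch. I §1 no. 1 (product of Lie algebras)] -/
private theorem apply_mem_center_of_mem_center_directSum {x : ⨁ k, M k} (hx : x ∈ LieAlgebra.center R (⨁ k, M k)) (k : κ) :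
    x k ∈ LieAlgebra.center R (M k) := by
  rw [LieModule.mem_maxTrivSubmodule] at hx ⊢
  intro w
  have := congrArg (fun v ↦ v k) (hx (DirectSum.of M k w))
  simpa only [DirectSum.bracket_apply, DirectSum.of_eq_same, DirectSum.zero_apply] using this

omit [DecidableEq κ] in
/-- A family of central components assembles to a central element of `⨁ₖ L_k`. [cite: Bourbaki1989LieGroups13, Ch. I §1 no. 1] -/
private theorem symm_mem_center_directSum (g : Π k, ↥(LieAlgebra.center R (M k))) :
    (DirectSum.linearEquivFunOnFintype R κ M).symm (fun k ↦ (g k : M k)) ∈ LieAlgebra.center R (⨁ k, M k) := by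
  rw [LieModule.mem_maxTrivSubmodule]
  intro y
  ext j
  have hj : ((DirectSum.linearEquivFunOnFintype R κ M).symm (fun k ↦ (g k : M k))) j = (g j : M j) :=
    congrFun ((DirectSum.linearEquivFunOnFintype R κ M).apply_symm_apply (fun k ↦ (g k : M k))) j
  have hg := (LieModule.mem_maxTrivSubmodule R (M j) (M j) (g j : M j)).1 (g j).2 (y j)
  rw [DirectSum.bracket_apply, DirectSum.zero_apply, hj, hg]

/-- **`𝔷(⨁ₖ L_k) ≃ₗ[R] Πₖ 𝔷(L_k)` FOR A FINITE DIRECT SUM OF LIE ALGEBRAS** (`x ↦ (x_k)_k`; the bracket is componentwise).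
[cite: Bourbaki1989LieGroups13, Ch. I §1 no. 1 (product of Lie algebras) and §6 no. 4] -/
theorem nonempty_center_directSum_linearEquiv_pi :
    Nonempty (↥(LieAlgebra.center R (⨁ k, M k)) ≃ₗ[R] (Π k, ↥(LieAlgebra.center R (M k)))) := by
  let f : ↥(LieAlgebra.center R (⨁ k, M k)) →ₗ[R] (Π k, ↥(LieAlgebra.center R (M k))) :=
    { toFun := fun x k ↦ ⟨(x : ⨁ k, M k) k, apply_mem_center_of_mem_center_directSum x.2 k⟩
      map_add' := fun x y ↦ funext fun k ↦ Subtype.ext (by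
        change ((x : ⨁ k, M k) + y) k = (x : ⨁ k, M k) k + (y : ⨁ k, M k) k
        exact DirectSum.add_apply _ _ _)
      map_smul' := fun c x ↦ funext fun k ↦ Subtype.ext (by
        change (c • (x : ⨁ k, M k)) k = c • (x : ⨁ k, M k) k
        exact DirectSum.smul_apply _ _ _) }
  refine ⟨LinearEquiv.ofBijective f ⟨fun x y hxy ↦ ?_, fun g ↦ ?_⟩⟩
  · apply Subtype.ext
    ext k
    have := congrArg (fun h : Π k, ↥(LieAlgebra.center R (M k)) ↦ ((h k : ↥(LieAlgebra.center R (M k))) : M k)) hxy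
    exact this
  · refine ⟨⟨(DirectSum.linearEquivFunOnFintype R κ M).symm (fun k ↦ (g k : M k)), symm_mem_center_directSum g⟩,
      funext fun k ↦ Subtype.ext ?_⟩
    change ((DirectSum.linearEquivFunOnFintype R κ M).symm (fun k ↦ (g k : M k))) k = (g k : M k)
    exact congrFun ((DirectSum.linearEquivFunOnFintype R κ M).apply_symm_apply (fun k ↦ (g k : M k))) k

/-- **`dim_R 𝔷(⨁ₖ L_k) = Σₖ dim_R 𝔷(L_k)`** (`R` a field in applications; stated for free finite modules via `finrank_pi_fintype`).
[cite: Bourbaki1989LieGroups13, Ch. I §1 no. 1 and §6 no. 4] -/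
theorem finrank_center_directSum_eq_sum {R : Type*} [Field R] {M : κ → Type*} [∀ k, LieRing (M k)] [∀ k, LieAlgebra R (M k)]
    [∀ k, Module.Finite R ↥(LieAlgebra.center R (M k))] :
    finrank R ↥(LieAlgebra.center R (⨁ k, M k)) = ∑ k, finrank R ↥(LieAlgebra.center R (M k)) := by
  obtain ⟨f⟩ := nonempty_center_directSum_linearEquiv_pi (R := R) (M := M)
  rw [f.finrank_eq, Module.finrank_pi_fintype]

end CenterPlumbing

/-! ## §2 Prop. 1.5 for `𝔷(Lie S(X))` and `𝒟Lie S(X)` -/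

section Factors

variable {ι : Type} [Fintype ι] [DecidableEq ι] {E : Type} [NormedAddCommGroup E] [NormedSpace ℂ E] [FiniteDimensional ℂ E]
  {Φ : (ι → ℝ) ≃L[ℝ] E} {η : E [⋀^Fin 2]→L[ℝ] ℝ} {G₀ : Matrix ι ι ℚ}
  {κ : Type} [Fintype κ] [DecidableEq κ] {σ : κ → Type} [∀ k, Fintype (σ k)] [∀ k, DecidableEq (σ k)] [∀ k, Nonempty (σ k)]
  {F : κ → Type} [∀ k, NormedAddCommGroup (F k)] [∀ k, NormedSpace ℂ (F k)] [∀ k, FiniteDimensional ℂ (F k)]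
  {Ψ : ∀ k, (σ k → ℝ) ≃L[ℝ] F k} {ω : ∀ k, F k [⋀^Fin 2]→L[ℝ] ℝ} {G : ∀ k, Matrix (σ k) (σ k) ℚ} {n : κ → ℕ}

omit [FiniteDimensional ℂ E] [∀ k, Nonempty (σ k)] [∀ k, FiniteDimensional ℂ (F k)] in
/-- **PROP. 1.5 FOR THE CENTRE: `dim_ℚ 𝔷(Lie S(X)) = Σₖ dim_ℚ 𝔷(Lie S(B_k))`** for `X ∼ ∏ₖ B_k^{n_k}` with simple pairwise non-isogenous
polarised `B_k`, `n_k ≥ 1` («Both `C₀(A)` and `C(A)` satisfy the statement of Proposition 1.1»: `S₀(A) ≃ ∏ S₀(A_i)` at the Lie algebra).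
[cite: Milne1999LefschetzClasses, §1 Prop. 1.1, Prop. 1.5 and p. 645 («`S₀(A)`», «satisfy the statement of Proposition 1.1»)]
[cite: Lange2023AbelianVarietiesComplex, §7.2.4 Exercise (4)(c)] -/
theorem IsIsogenous.finrank_center_lefschetzLieRat_eq_sum (hη : IsRiemannForm Φ η)
    (hG₀ : G₀.map (Rat.cast : ℚ → ℝ) = latticeGram Φ η) (h : ∀ k, IsRiemannForm (Ψ k) (ω k))
    (hG : ∀ k, (G k).map (Rat.cast : ℚ → ℝ) = latticeGram (Ψ k) (ω k)) (hs : ∀ k, IsSimple (Ψ k))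
    (hni : ∀ k l, k ≠ l → ¬ IsIsogenous (Ψ k) (Ψ l)) (hn : ∀ k, 0 < n k)
    (hX : IsIsogenous Φ (sigmaPiPeriod fun k ↦ powPeriod (Ψ k) (n k))) :
    finrank ℚ ↥(LieAlgebra.center ℚ ↥(lefschetzLieRat Φ G₀)) = ∑ k, finrank ℚ ↥(LieAlgebra.center ℚ ↥(lefschetzLieRat (Ψ k) (G k))) := by
  obtain ⟨e⟩ := hX.nonempty_lefschetzLieRat_lieEquiv_directSum_of_powers hη hG₀ h hG hs hni hn
  haveI : ∀ k, Module.Finite ℚ ↥(lefschetzLieRat (Ψ k) (G k)) := fun k ↦ finite_lefschetzLieRat (Ψ k) (G k)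
  haveI : ∀ k, Module.Finite ℚ ↥(LieAlgebra.center ℚ ↥(lefschetzLieRat (Ψ k) (G k))) := fun k ↦ inferInstance
  rw [Literature.Algebra.Lie.finrank_center_eq_of_lieEquiv e, finrank_center_directSum_eq_sum]

omit [FiniteDimensional ℂ E] [∀ k, FiniteDimensional ℂ (F k)] in
/-- **THE RANK OF MILNE'S `S₀` OVER THE FACTORS: `dim_ℚ 𝔷(Lie S(X)) + Σₖ [K_k⁺ : ℚ] = Σₖ [K_k : ℚ]`** (`K_k` the centre of `End_ℚ(B_k)`,
`K_k⁺` its maximal real subfield: a factor of type I–III contributes `0`, a factor of type IV contributes `e₀(B_k) = ½[K_k:ℚ]`), for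
`X ∼ ∏ₖ B_k^{n_k}` as above. [cite: Milne1999LefschetzClasses, §1 p. 645 («`C₀(A)` … a product of fields, each … a CM-field or …», «`S₀(A)`») and §2 p. 646]
[cite: Lange2023AbelianVarietiesComplex, §2.6.1 Proposition (column `e₀`)] -/
theorem IsIsogenous.finrank_center_lefschetzLieRat_add_sum_eq_sum (hη : IsRiemannForm Φ η)
    (hG₀ : G₀.map (Rat.cast : ℚ → ℝ) = latticeGram Φ η) (h : ∀ k, IsRiemannForm (Ψ k) (ω k))
    (hG : ∀ k, (G k).map (Rat.cast : ℚ → ℝ) = latticeGram (Ψ k) (ω k)) (hs : ∀ k, IsSimple (Ψ k))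
    (hni : ∀ k l, k ≠ l → ¬ IsIsogenous (Ψ k) (Ψ l)) (hn : ∀ k, 0 < n k)
    (hX : IsIsogenous Φ (sigmaPiPeriod fun k ↦ powPeriod (Ψ k) (n k))) :
    finrank ℚ ↥(LieAlgebra.center ℚ ↥(lefschetzLieRat Φ G₀)) + ∑ k, finrank ℚ ↥(maximalRealSubfield (centerField (Ψ k) (hs k))) =
      ∑ k, finrank ℚ (centerField (Ψ k) (hs k)) := by
  rw [hX.finrank_center_lefschetzLieRat_eq_sum hη hG₀ h hG hs hni hn, ← Finset.sum_add_distrib]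
  exact Finset.sum_congr rfl fun k _ ↦ (hs k).finrank_center_lefschetzLieRat_add_finrank_maximalRealSubfield_eq (h k) (hG k)

omit [FiniteDimensional ℂ E] [∀ k, FiniteDimensional ℂ (F k)] in
/-- No factor of type IV ⟹ `dim_ℚ 𝔷(Lie S(X)) = 0` (the count behind ✔ g60-#3's `𝔷 = 0`). [cite: Milne1999LefschetzClasses, §2 p. 646 and Summary table p. 652]
[cite: MoonenZarhin1999LowDim, §1] -/
theorem IsIsogenous.finrank_center_lefschetzLieRat_eq_zero_of_forall_isTotallyReal (hη : IsRiemannForm Φ η)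
    (hG₀ : G₀.map (Rat.cast : ℚ → ℝ) = latticeGram Φ η) (h : ∀ k, IsRiemannForm (Ψ k) (ω k))
    (hG : ∀ k, (G k).map (Rat.cast : ℚ → ℝ) = latticeGram (Ψ k) (ω k)) (hs : ∀ k, IsSimple (Ψ k))
    (hni : ∀ k l, k ≠ l → ¬ IsIsogenous (Ψ k) (Ψ l)) (hn : ∀ k, 0 < n k)
    (hX : IsIsogenous Φ (sigmaPiPeriod fun k ↦ powPeriod (Ψ k) (n k))) (hK : ∀ k, IsTotallyReal (centerField (Ψ k) (hs k))) :
    finrank ℚ ↥(LieAlgebra.center ℚ ↥(lefschetzLieRat Φ G₀)) = 0 := by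
  rw [hX.finrank_center_lefschetzLieRat_eq_sum hη hG₀ h hG hs hni hn]
  exact Finset.sum_eq_zero fun k _ ↦ by
    haveI := hK k
    exact (hs k).finrank_center_lefschetzLieRat_eq_zero_of_isTotallyReal (h k) (hG k)

omit [∀ k, Nonempty (σ k)] in
/-- **PROP. 1.5 FOR THE SEMISIMPLE PART: `dim_ℚ 𝒟Lie S(X) = Σₖ dim_ℚ 𝒟Lie S(B_k)`** (`Lie S = 𝔷 ⊕ 𝒟` on `X` and on every `B_k`,
`dim Lie S(X) = Σₖ dim Lie S(B_k)` and the centre count). [cite: Milne1999LefschetzClasses, §1 Prop. 1.5 and p. 644 («a reductive group … whose nonabelian simple quotients are classical groups»)]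
[cite: Bourbaki1989LieGroups13, Ch. I §6 no. 4 Prop. 5 (c)] -/
theorem IsIsogenous.finrank_derived_lefschetzLieRat_eq_sum (hη : IsRiemannForm Φ η)
    (hG₀ : G₀.map (Rat.cast : ℚ → ℝ) = latticeGram Φ η) (h : ∀ k, IsRiemannForm (Ψ k) (ω k))
    (hG : ∀ k, (G k).map (Rat.cast : ℚ → ℝ) = latticeGram (Ψ k) (ω k)) (hs : ∀ k, IsSimple (Ψ k))
    (hni : ∀ k l, k ≠ l → ¬ IsIsogenous (Ψ k) (Ψ l)) (hn : ∀ k, 0 < n k)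
    (hX : IsIsogenous Φ (sigmaPiPeriod fun k ↦ powPeriod (Ψ k) (n k))) :
    finrank ℚ ↥(LieAlgebra.derivedSeries ℚ ↥(lefschetzLieRat Φ G₀) 1) =
      ∑ k, finrank ℚ ↥(LieAlgebra.derivedSeries ℚ ↥(lefschetzLieRat (Ψ k) (G k)) 1) := by
  have hX' := hX.finrank_lefschetzLieRat_eq_sum hη hG₀ h hG hs hni hn
  have hZ := hX.finrank_center_lefschetzLieRat_eq_sum hη hG₀ h hG hs hni hn
  have hsplit := hη.finrank_center_add_finrank_derived_lefschetzLieRat hG₀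
  have hsplitk : ∀ k, finrank ℚ ↥(LieAlgebra.center ℚ ↥(lefschetzLieRat (Ψ k) (G k))) +
      finrank ℚ ↥(LieAlgebra.derivedSeries ℚ ↥(lefschetzLieRat (Ψ k) (G k)) 1) = finrank ℚ ↥(lefschetzLieRat (Ψ k) (G k)) :=
    fun k ↦ (h k).finrank_center_add_finrank_derived_lefschetzLieRat (hG k)
  have hsum : ∑ k, finrank ℚ ↥(lefschetzLieRat (Ψ k) (G k)) =
      ∑ k, finrank ℚ ↥(LieAlgebra.center ℚ ↥(lefschetzLieRat (Ψ k) (G k))) +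
        ∑ k, finrank ℚ ↥(LieAlgebra.derivedSeries ℚ ↥(lefschetzLieRat (Ψ k) (G k)) 1) := by
    rw [← Finset.sum_add_distrib]
    exact Finset.sum_congr rfl fun k _ ↦ (hsplitk k).symm
  omega

end Factors

end ComplexTorus

end Literature.Geometry.Kaehler

end
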